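import Mathlib.Analysis.ODE.ExistUnique
import Mathlib.Analysis.Calculus.Deriv.Prod
import Mathlib.Analysis.Calculus.ContDiff.RCLike
import Mathlib.Analysis.InnerProductSpace.PiL2
import Literature.Analysis.FluidPDE.FiniteFourierModeEulerSIP

/-!
# Kishimoto–Yoneda: the Fourier-side Euler system as an ODE; local stationarity is global

Support file for `FiniteFourierModeEuler` (N. Kishimoto, T. Yoneda, J. Math. Fluid Mech. 24
(2022) 74 = arXiv:2110.08039). The paper observes (after (1.5)) that (1.3) is an autonomous ODE
system for the finitely many coefficient vectors `{u_n(t)}_{n ∈ S}` with polynomial right-hand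
side, whence real analyticity in `t`; it uses this only to pass from "`∂_t u = 0` on the dense set
`I ∖ I₀`" to "`u` is stationary". We PROVE the substitute we need, by ODE uniqueness instead of
analyticity:

* `extState`, `vf`, `traj`: the state `(u_n(t))_{n ∈ S} ∈ (S → ℂ³)`, its zero extension to all
  frequencies, and the vector field `x ↦ (-(nonlinearity of (1.3))_n)_{n ∈ S}`; `vf` is `C¹`
  (`contDiff_vf`, a polynomial map) and the state of a finite-mode Euler solution is an integral
  curve of `vf` on `I` (`hasDerivAt_traj`);
* `IsFiniteModeEulerSolution.stationary_of_stationary_on_Ioo`: if a finite-mode Euler solution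
  is independent of time on some non-empty open subinterval of `I`, it is independent of time on
  all of `I` (Picard–Lindelöf uniqueness, Mathlib's `ODE_solution_unique_of_mem_Icc_right/left`,
  with the Lipschitz constant of the `C¹` field on a large closed ball).

## References

* [KishimotoYoneda2022] N. Kishimoto, T. Yoneda, J. Math. Fluid Mech. 24 (2022) 74 =
  arXiv:2110.08039, §1 (1.3) and the paragraph after (1.5) (real analyticity / `I₀`).
-/

noncomputable section

open Matrix Finset Set Metric

namespace Literature.Analysis.FluidPDE

namespace KY

variable (S : Finset (Fin 3 → ℝ))

open scoped Classical in
/-- Zero extension of a state `x : S → ℂ³` to all frequencies ("`u_n = 0` if `n ∉ S`").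
[cite: KishimotoYoneda2022, §1 Def. 1.1] -/
def extState (x : ↥S → Fin 3 → ℂ) : (Fin 3 → ℝ) → (Fin 3 → ℂ) :=
  fun m => if h : m ∈ S then x ⟨m, h⟩ else 0

/-- The vector field of the Fourier-side Euler system (1.3) on the state space `S → ℂ³`:
`x ↦ (-(i/2) P̂_n Σ_{n₁+n₂=n} [(x_{n₁}·n₂)x_{n₂} + (x_{n₂}·n₁)x_{n₁}])_{n ∈ S}`.
[cite: KishimotoYoneda2022, §1 (1.3)] -/
def vf (x : ↥S → Fin 3 → ℂ) : ↥S → Fin 3 → ℂ :=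
  fun n i => -(nonlin S (extState S x) n i)

/-- The state of a coefficient family at time `t`. [cite: KishimotoYoneda2022, §1 (1.3)] -/
def traj (u : (Fin 3 → ℝ) → ℝ → (Fin 3 → ℂ)) (t : ℝ) : ↥S → Fin 3 → ℂ :=
  fun n => u n t

variable {S}

/-- [cite: KishimotoYoneda2022, §1 Def. 1.1] -/
theorem extState_apply_of_mem (x : ↥S → Fin 3 → ℂ) {m : Fin 3 → ℝ} (hm : m ∈ S) :
    extState S x m = x ⟨m, hm⟩ := by
  simp [extState, hm]

/-- [cite: KishimotoYoneda2022, §1 Def. 1.1] -/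
theorem extState_apply_of_notMem (x : ↥S → Fin 3 → ℂ) {m : Fin 3 → ℝ} (hm : m ∉ S) :
    extState S x m = 0 := by
  simp [extState, hm]

/-- [cite: KishimotoYoneda2022, §1 (1.3)] -/
theorem traj_apply (u : (Fin 3 → ℝ) → ℝ → (Fin 3 → ℂ)) (t : ℝ) (n : ↥S) : traj S u t n = u n t := rfl

/-! ### The vector field is `C¹` (a polynomial map) -/

open scoped Classical in
/-- One projected pair bracket, as a function of the state, is smooth. [cite: KishimotoYoneda2022, §1 (1.3)] -/
theorem contDiff_proj_bracket (n : Fin 3 → ℝ) {a b : Fin 3 → ℝ} (ha : a ∈ S) (hb : b ∈ S) (i : Fin 3) :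
    ContDiff ℝ 1 fun x : ↥S → Fin 3 → ℂ =>
      proj n (bracket a b (extState S x a) (extState S x b)) i := by
  simp only [extState, ha, hb, dif_pos, proj, bracket, dot_eq, Pi.add_apply, Pi.sub_apply,
    Pi.smul_apply, smul_eq_mul]
  fun_prop

open scoped Classical in
/-- **The vector field of (1.3) is `C¹`.** [cite: KishimotoYoneda2022, §1 (after (1.5))] -/
theorem contDiff_vf : ContDiff ℝ 1 (vf S) := by
  rw [contDiff_pi]
  intro n
  rw [contDiff_pi]
  intro i
  have h : (fun x : ↥S → Fin 3 → ℂ => vf S x n i) = fun x =>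
      -((Complex.I / 2) * ∑ q ∈ (S ×ˢ S).filter (fun q => q.1 + q.2 = (n : Fin 3 → ℝ)),
        proj n (bracket q.1 q.2 (extState S x q.1) (extState S x q.2)) i) := by
    funext x
    simp only [vf, nonlin_apply_eq, Pi.smul_apply, Finset.sum_apply, smul_eq_mul]
  rw [h]
  refine ContDiff.neg (ContDiff.mul contDiff_const (ContDiff.sum fun q hq => ?_))
  have hq' := (Finset.mem_filter.1 hq).1
  rw [Finset.mem_product] at hq'
  exact contDiff_proj_bracket n hq'.1 hq'.2 i

end KY

namespace KY.IsFiniteModeEulerSolution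

open KY

variable {I : Set ℝ} {S : Finset (Fin 3 → ℝ)} {u : (Fin 3 → ℝ) → ℝ → (Fin 3 → ℂ)}

/-- The zero extension of the state of a solution is the full coefficient family.
[cite: KishimotoYoneda2022, §1 Def. 1.1] -/
theorem extState_traj (hS : IsFiniteModeEulerSolution I S u) (t : ℝ) :
    extState S (traj S u t) = fun m => u m t := by
  funext m
  by_cases hm : m ∈ S
  · rw [extState_apply_of_mem _ hm]; rfl
  · rw [extState_apply_of_notMem _ hm, hS.eq_zero_of_notMem m hm t]

/-- **The state of a finite-mode Euler solution is an integral curve of `vf` on `I`.**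
[cite: KishimotoYoneda2022, §1 (1.3)] -/
theorem hasDerivAt_traj (hS : IsFiniteModeEulerSolution I S u) {t : ℝ} (ht : t ∈ I) :
    HasDerivAt (traj S u) (vf S (traj S u t)) t := by
  rw [hasDerivAt_pi]
  intro n
  rw [hasDerivAt_pi]
  intro i
  have hd : DifferentiableAt ℝ (fun s => u n s i) t :=
    (hS.differentiableOn n i).differentiableAt (hS.isOpen.mem_nhds ht)
  have := hd.hasDerivAt
  rw [hS.deriv_eq (hS.ne_zero_of_mem n.2) ht i] at this
  simpa [vf, hS.extState_traj t, traj] using this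

/-- [cite: KishimotoYoneda2022, §1 (1.3)] -/
theorem continuousOn_traj (hS : IsFiniteModeEulerSolution I S u) : ContinuousOn (traj S u) I :=
  fun _ ht => (hS.hasDerivAt_traj ht).continuousAt.continuousWithinAt

/-- If the solution is constant on a neighbourhood of `t₀`, the vector field vanishes at its state.
[cite: KishimotoYoneda2022, §1 (1.3)] -/
theorem vf_traj_eq_zero (hS : IsFiniteModeEulerSolution I S u) {c d t₀ : ℝ} (ht₀ : t₀ ∈ Set.Ioo c d)
    (hsub : Set.Ioo c d ⊆ I) (hconst : ∀ n, ∀ t ∈ Set.Ioo c d, u n t = u n t₀) :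
    vf S (traj S u t₀) = 0 := by
  have h1 := hS.hasDerivAt_traj (hsub ht₀)
  have h2 : HasDerivAt (traj S u) 0 t₀ := by
    refine (hasDerivAt_const t₀ (traj S u t₀)).congr_of_eventuallyEq ?_
    filter_upwards [isOpen_Ioo.mem_nhds ht₀] with s hs
    funext n
    exact hconst n s hs
  exact h1.unique h2

/-- **Local stationarity is global.** If a finite-mode Euler solution is independent of time on a
non-empty open subinterval `(c, d) ⊆ I`, it is independent of time on `I` (uniqueness for the ODE
(1.3), whose right-hand side is locally Lipschitz). [cite: KishimotoYoneda2022, §1 (after (1.5))] -/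
theorem stationary_of_stationary_on_Ioo (hS : IsFiniteModeEulerSolution I S u) {c d : ℝ}
    (hcd : c < d) (hsub : Set.Ioo c d ⊆ I)
    (hconst : ∀ n, ∀ t ∈ Set.Ioo c d, ∀ s ∈ Set.Ioo c d, u n t = u n s)
    (n : Fin 3 → ℝ) {t s : ℝ} (ht : t ∈ I) (hs : s ∈ I) : u n t = u n s := by
  -- reduce to the state and the midpoint `t₀`
  set t₀ : ℝ := (c + d) / 2 with ht₀def
  have ht₀ : t₀ ∈ Set.Ioo c d := ⟨by rw [ht₀def]; linarith, by rw [ht₀def]; linarith⟩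
  have hI₀ : t₀ ∈ I := hsub ht₀
  set x₀ := traj S u t₀ with hx₀
  have hvf0 : vf S x₀ = 0 := hS.vf_traj_eq_zero ht₀ hsub (fun n t ht => hconst n t ht t₀ ht₀)
  -- the key claim: the state is constantly `x₀` on `I`
  suffices key : ∀ t₁ ∈ I, traj S u t₁ = x₀ by
    by_cases hn : n ∈ S
    · have h1 := congrFun (key t ht) ⟨n, hn⟩
      have h2 := congrFun (key s hs) ⟨n, hn⟩
      simp only [traj_apply] at h1 h2
      rw [h1, h2]
    · rw [hS.eq_zero_of_notMem n hn t, hS.eq_zero_of_notMem n hn s]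
  intro t₁ ht₁
  -- a closed ball containing the trajectory over `[min t₀ t₁, max t₀ t₁] ⊆ I`
  have hIcc : Set.Icc (min t₀ t₁) (max t₀ t₁) ⊆ I := by
    rcases le_total t₀ t₁ with h | h
    · rw [min_eq_left h, max_eq_right h]; exact hS.ordConnected.out hI₀ ht₁
    · rw [min_eq_right h, max_eq_left h]; exact hS.ordConnected.out ht₁ hI₀
  have hcont : ContinuousOn (traj S u) (Set.Icc (min t₀ t₁) (max t₀ t₁)) :=
    hS.continuousOn_traj.mono hIcc
  obtain ⟨R, hR⟩ := ((isCompact_Icc.image_of_continuousOn hcont).isBounded).subset_closedBall 0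
  have hmemR : ∀ t' ∈ Set.Icc (min t₀ t₁) (max t₀ t₁), traj S u t' ∈ closedBall (0 : ↥S → Fin 3 → ℂ) R :=
    fun t' ht' => hR ⟨t', ht', rfl⟩
  have hx₀R : x₀ ∈ closedBall (0 : ↥S → Fin 3 → ℂ) R :=
    hmemR t₀ ⟨min_le_left _ _, le_max_left _ _⟩
  -- the field is Lipschitz on that ball
  obtain ⟨K, hK⟩ := (contDiff_vf (S := S)).contDiffOn.exists_lipschitzOnWith one_ne_zero
    (convex_closedBall _ _) (isCompact_closedBall _ _)
  -- uniqueness, forwards or backwards in time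
  rcases le_total t₀ t₁ with h01 | h10
  · have := ODE_solution_unique_of_mem_Icc_right (v := fun _ => vf S)
      (s := fun _ => closedBall (0 : ↥S → Fin 3 → ℂ) R) (K := K) (f := traj S u) (g := fun _ => x₀)
      (a := t₀) (b := t₁) (fun _ _ => hK)
      (hcont.mono (by rw [min_eq_left h01, max_eq_right h01]))
      (fun t' ht' => (hS.hasDerivAt_traj (hIcc (by
          rw [min_eq_left h01, max_eq_right h01]; exact Ico_subset_Icc_self ht'))).hasDerivWithinAt)
      (fun t' ht' => hmemR t' (by rw [min_eq_left h01, max_eq_right h01]; exact Ico_subset_Icc_self ht'))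
      continuousOn_const
      (fun t' _ => by rw [hvf0]; exact (hasDerivAt_const t' x₀).hasDerivWithinAt)
      (fun _ _ => hx₀R) rfl
    exact this ⟨h01, le_rfl⟩
  · have := ODE_solution_unique_of_mem_Icc_left (v := fun _ => vf S)
      (s := fun _ => closedBall (0 : ↥S → Fin 3 → ℂ) R) (K := K) (f := traj S u) (g := fun _ => x₀)
      (a := t₁) (b := t₀) (fun _ _ => hK)
      (hcont.mono (by rw [min_eq_right h10, max_eq_left h10]))
      (fun t' ht' => (hS.hasDerivAt_traj (hIcc (by
          rw [min_eq_right h10, max_eq_left h10]; exact Ioc_subset_Icc_self ht'))).hasDerivWithinAt)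
      (fun t' ht' => hmemR t' (by rw [min_eq_right h10, max_eq_left h10]; exact Ioc_subset_Icc_self ht'))
      continuousOn_const
      (fun t' _ => by rw [hvf0]; exact (hasDerivAt_const t' x₀).hasDerivWithinAt)
      (fun _ _ => hx₀R) rfl
    exact this ⟨le_rfl, h10⟩

end KY.IsFiniteModeEulerSolution

end Literature.Analysis.FluidPDE
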